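import Mathlib
import Summits.Ventures.PercRepro2.Defs
import Summits.Ventures.PercRepro2.Independence
import Summits.Ventures.PercRepro2.Harris
import Summits.Ventures.PercRepro2.CoinDefs
import Summits.Ventures.PercRepro2.CoinArcsOff
import Summits.Ventures.PercRepro2.CoinPendantDefs
import Summits.Ventures.PercRepro2.CoinTraceLevels
import Summits.Ventures.PercRepro2.CoinKStarLattice
import Summits.Ventures.PercRepro2.CoinKStarTilt
import Summits.Ventures.PercRepro2.CoinKStarLaw
import Summits.Ventures.PercRepro2.CoinKStarTrace

/-!
# The trace law of a pendant FOREST is log-supermodular (blind cell PercRepro2, night-2 g5;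
proofs/NIGHT2-DARC.md §27.2)

A pendant forest below `t`: every vertex `v ∈ Vs` has exactly one out-coin `d v = {v → par v}`
with `par v ∈ Vs ∪ {t}`, the parent map is well-founded (a rank decreases along it), and the
forest coins are the only coins with tails in `Vs`.  Then `K⁻ ∩ Vs` is a DOWN-CLOSED set `L`
(`v ∈ L ⟹ par v ∈ L ∪ {t}`), its level is the cylinder «`d v` open for `v ∈ L`, closed for `v`
in the BOUNDARY `bdry L = {v ∉ L : par v ∈ L ∪ {t}}`», so `P(K⁻ ∩ Vs = L) =
∏_{v ∈ L} p (d v) · ∏_{v ∈ bdry L} (1 − p (d v))` (and `0` off the down-closed sets); the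
`p`-part is log-modular and `bdry (L ∩ L') ⊎ bdry (L ∪ L') ⊆ bdry L ⊎ bdry L'` (as multisets)
makes the `(1 − p)`-part log-supermodular.  `forest_trace_lsm` is the hypothesis `hβ` of
`darc_of_lsmHead_mixed`.
-/

namespace Summit.Ventures.PercRepro2.Coin

section ForestLaw

open Classical

variable {V : Type*} {E : Type*} [Fintype V] [DecidableEq V] [Fintype E] [DecidableEq E]
  {R : Type*} [Field R] [LinearOrder R] [IsStrictOrderedRing R]

/-- `L` is down-closed in the forest: parents of members are members or `t`. -/
def DownClosed (par : V → V) (t : V) (L : Finset V) : Prop := ∀ v ∈ L, par v ∈ L ∨ par v = t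

/-- The boundary of `L`: the non-members whose parent is a member or `t`. -/
def bdry (Vs : Finset V) (par : V → V) (t : V) (L : Finset V) : Finset V :=
  Vs.filter (fun v => v ∉ L ∧ (par v ∈ L ∨ par v = t))

omit [Fintype V] [Fintype E] [DecidableEq E] [Field R] [LinearOrder R] [IsStrictOrderedRing R] in
/-- Membership in the boundary, unfolded. -/
lemma mem_bdry_iff {Vs : Finset V} {par : V → V} {t : V} {L : Finset V} {v : V} :
    v ∈ bdry Vs par t L ↔ v ∈ Vs ∧ v ∉ L ∧ (par v ∈ L ∨ par v = t) := by
  simp [bdry]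

omit [Fintype V] [Fintype E] [DecidableEq E] [Field R] [LinearOrder R] [IsStrictOrderedRing R] in
/-- Down-closed sets are closed under intersection. -/
lemma downClosed_inter {par : V → V} {t : V} {L L' : Finset V} (h : DownClosed par t L)
    (h' : DownClosed par t L') : DownClosed par t (L ∩ L') := by
  intro v hv
  rcases h v (Finset.mem_inter.mp hv).1 with h1 | h1
  · rcases h' v (Finset.mem_inter.mp hv).2 with h2 | h2
    · exact Or.inl (Finset.mem_inter.mpr ⟨h1, h2⟩)
    · exact Or.inr h2
  · exact Or.inr h1

omit [Fintype V] [Fintype E] [DecidableEq E] [Field R] [LinearOrder R] [IsStrictOrderedRing R] in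
/-- Down-closed sets are closed under union. -/
lemma downClosed_union {par : V → V} {t : V} {L L' : Finset V} (h : DownClosed par t L)
    (h' : DownClosed par t L') : DownClosed par t (L ∪ L') := by
  intro v hv
  rcases Finset.mem_union.mp hv with hv | hv
  · rcases h v hv with h1 | h1
    · exact Or.inl (Finset.mem_union_left _ h1)
    · exact Or.inr h1
  · rcases h' v hv with h1 | h1
    · exact Or.inl (Finset.mem_union_right _ h1)
    · exact Or.inr h1

omit [Fintype V] [Fintype E] [DecidableEq E] [Field R] [LinearOrder R] [IsStrictOrderedRing R] in
/-- The boundaries of the intersection and the union are covered by the two boundaries. -/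
lemma bdry_inter_union_subset (Vs : Finset V) (par : V → V) (t : V) (L L' : Finset V) :
    bdry Vs par t (L ∩ L') ∪ bdry Vs par t (L ∪ L') ⊆ bdry Vs par t L ∪ bdry Vs par t L' := by
  intro v hv
  simp only [Finset.mem_union, mem_bdry_iff, Finset.mem_inter] at hv ⊢
  rcases hv with ⟨hV, hvL, hpar⟩ | ⟨hV, hvL, hpar⟩
  · by_cases hL : v ∈ L
    · have hL' : v ∉ L' := fun h => hvL ⟨hL, h⟩
      right
      refine ⟨hV, hL', ?_⟩
      rcases hpar with h | h
      · exact Or.inl h.2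
      · exact Or.inr h
    · left
      refine ⟨hV, hL, ?_⟩
      rcases hpar with h | h
      · exact Or.inl h.1
      · exact Or.inr h
  · have hL : v ∉ L := fun h => hvL (Or.inl h)
    have hL' : v ∉ L' := fun h => hvL (Or.inr h)
    rcases hpar with h | h
    · rcases h with h | h
      · exact Or.inl ⟨hV, hL, Or.inl h⟩
      · exact Or.inr ⟨hV, hL', Or.inl h⟩
    · exact Or.inl ⟨hV, hL, Or.inr h⟩

omit [Fintype V] [Fintype E] [DecidableEq E] [Field R] [LinearOrder R] [IsStrictOrderedRing R] in
/-- A vertex in both boundaries of the intersection and the union is in both boundaries. -/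
lemma bdry_inter_inter_union_subset (Vs : Finset V) (par : V → V) (t : V) (L L' : Finset V) :
    bdry Vs par t (L ∩ L') ∩ bdry Vs par t (L ∪ L') ⊆ bdry Vs par t L ∩ bdry Vs par t L' := by
  intro v hv
  simp only [Finset.mem_inter, mem_bdry_iff] at hv ⊢
  obtain ⟨⟨hV, _, hpar⟩, ⟨_, hvU, _⟩⟩ := hv
  have hL : v ∉ L := fun h => hvU (Finset.mem_union_left _ h)
  have hL' : v ∉ L' := fun h => hvU (Finset.mem_union_right _ h)
  rcases hpar with h | h
  · exact ⟨⟨hV, hL, Or.inl h.1⟩, ⟨hV, hL', Or.inl h.2⟩⟩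
  · exact ⟨⟨hV, hL, Or.inr h⟩, ⟨hV, hL', Or.inr h⟩⟩

omit [Fintype V] in
/-- A product of factors in `[0, 1]` over a subset dominates the product over the whole set. -/
lemma prod_le_prod_of_subset_of_mem_Icc {f : V → R} (hf0 : ∀ v, 0 ≤ f v) (hf1 : ∀ v, f v ≤ 1)
    {A B : Finset V} (h : A ⊆ B) : ∏ v ∈ B, f v ≤ ∏ v ∈ A, f v := by
  rw [← Finset.prod_sdiff h]
  have h1 : ∏ v ∈ B \ A, f v ≤ 1 := Finset.prod_le_one (fun v _ => hf0 v) (fun v _ => hf1 v)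
  have h0 : 0 ≤ ∏ v ∈ A, f v := Finset.prod_nonneg fun v _ => hf0 v
  calc (∏ v ∈ B \ A, f v) * ∏ v ∈ A, f v ≤ 1 * ∏ v ∈ A, f v := mul_le_mul_of_nonneg_right h1 h0
    _ = ∏ v ∈ A, f v := one_mul _

omit [Fintype V] in
/-- **Log-supermodularity of the boundary products**:
`∏_{bdry L} g · ∏_{bdry L'} g ≤ ∏_{bdry (L ∩ L')} g · ∏_{bdry (L ∪ L')} g` for `g ∈ [0, 1]`. -/
lemma bdry_prod_lsm (Vs : Finset V) (par : V → V) (t : V) {g : V → R} (hg0 : ∀ v, 0 ≤ g v)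
    (hg1 : ∀ v, g v ≤ 1) (L L' : Finset V) :
    (∏ v ∈ bdry Vs par t L, g v) * ∏ v ∈ bdry Vs par t L', g v ≤
      (∏ v ∈ bdry Vs par t (L ∩ L'), g v) * ∏ v ∈ bdry Vs par t (L ∪ L'), g v := by
  rw [← Finset.prod_union_inter, ← Finset.prod_union_inter (s₁ := bdry Vs par t (L ∩ L'))]
  exact mul_le_mul
    (prod_le_prod_of_subset_of_mem_Icc hg0 hg1 (bdry_inter_union_subset Vs par t L L'))
    (prod_le_prod_of_subset_of_mem_Icc hg0 hg1 (bdry_inter_inter_union_subset Vs par t L L'))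
    (Finset.prod_nonneg fun v _ => hg0 v) (Finset.prod_nonneg fun v _ => hg0 v)

/-! ### The levels of a forest -/

section Levels

variable {arcs : E → Finset (V × V)} {Vs : Finset V} {t : V} {par : V → V} {d : V → E}

omit [Fintype V] [DecidableEq V] [Fintype E] [DecidableEq E] [Field R] [LinearOrder R]
  [IsStrictOrderedRing R] in
/-- The only open arc out of a forest vertex goes to its parent, through its coin. -/
lemma forest_first_arc (hd : ∀ v ∈ Vs, arcs (d v) = {(v, par v)})
    (honly : ∀ e, (∃ xy ∈ arcs e, xy.1 ∈ Vs) → ∃ v ∈ Vs, e = d v) {ω : Config E} {v y : V}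
    (hv : v ∈ Vs) (h : OpenArc arcs ω v y) : y = par v ∧ ω (d v) = true := by
  obtain ⟨e, he, hxy⟩ := h
  obtain ⟨v', hv', rfl⟩ := honly e ⟨(v, y), hxy, hv⟩
  rw [hd v' hv', Finset.mem_singleton, Prod.mk.injEq] at hxy
  obtain ⟨rfl, rfl⟩ := hxy
  exact ⟨rfl, he⟩

omit [Fintype V] [DecidableEq V] [Fintype E] [DecidableEq E] [Field R] [LinearOrder R]
  [IsStrictOrderedRing R] in
/-- The forest coins are injective. -/
lemma forest_d_injOn (hd : ∀ v ∈ Vs, arcs (d v) = {(v, par v)}) : Set.InjOn d Vs := by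
  intro v hv v' hv' h
  have h1 := hd v hv
  have h2 := hd v' hv'
  rw [h] at h1
  rw [h1, Finset.singleton_inj, Prod.mk.injEq] at h2
  exact h2.1

omit [Fintype V] [DecidableEq V] [Fintype E] [DecidableEq E] [Field R] [LinearOrder R]
  [IsStrictOrderedRing R] in
/-- Down-closed `L` with its coins open: every member reaches `t` (induction on the rank). -/
lemma forest_reach_of_mem (hd : ∀ v ∈ Vs, arcs (d v) = {(v, par v)}) {rk : V → ℕ}
    (hrk : ∀ v ∈ Vs, par v ∈ Vs → rk (par v) < rk v) {L : Finset V} (hL : L ⊆ Vs)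
    (hdc : DownClosed par t L) {ω : Config E} (hopen : ∀ v ∈ L, ω (d v) = true) :
    ∀ v ∈ L, Reach arcs ω v t := by
  have key : ∀ n, ∀ v, v ∈ L → rk v = n → Reach arcs ω v t := by
    intro n
    induction n using Nat.strong_induction_on with
    | _ n ih =>
      intro v hv hn
      have harc : OpenArc arcs ω v (par v) :=
        ⟨d v, hopen v hv, by rw [hd v (hL hv)]; exact Finset.mem_singleton_self _⟩
      rcases hdc v hv with hp | hp
      · have hrank := hrk v (hL hv) (hL hp)
        exact reach_trans (reach_of_openArc harc) (ih (rk (par v)) (hn ▸ hrank) (par v) hp rfl)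
      · rw [hp] at harc
        exact reach_of_openArc harc
  exact fun v hv => key (rk v) v hv rfl

omit [Fintype V] [Fintype E] [DecidableEq E] [Field R] [LinearOrder R] [IsStrictOrderedRing R] in
/-- Boundary coins closed: a forest vertex that reaches `t` lies in `L` (induction along the
path). -/
lemma forest_mem_of_reach (htV : t ∉ Vs) (hd : ∀ v ∈ Vs, arcs (d v) = {(v, par v)})
    (hpar : ∀ v ∈ Vs, par v ∈ Vs ∨ par v = t)
    (honly : ∀ e, (∃ xy ∈ arcs e, xy.1 ∈ Vs) → ∃ v ∈ Vs, e = d v) {L : Finset V}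
    {ω : Config E} (hclosed : ∀ v ∈ bdry Vs par t L, ω (d v) = false) :
    ∀ v ∈ Vs, Reach arcs ω v t → v ∈ L := by
  intro v hv hreach
  revert hv
  induction hreach using Relation.ReflTransGen.head_induction_on with
  | refl => exact fun h => absurd h htV
  | @head x y hxy _ ih =>
  intro hxV
  obtain ⟨rfl, hopen⟩ := forest_first_arc hd honly hxV hxy
  by_contra hxL
  have hb : x ∈ bdry Vs par t L := by
    rw [mem_bdry_iff]
    refine ⟨hxV, hxL, ?_⟩
    rcases hpar x hxV with h | h
    · exact Or.inl (ih h)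
    · exact Or.inr h
  have := hclosed x hb
  rw [hopen] at this
  exact Bool.true_eq_false.mp this |>.elim

omit [Fintype V] [Fintype E] [Field R] [LinearOrder R] [IsStrictOrderedRing R] in
/-- **The level of a down-closed trace is a cylinder**: its coins open, its boundary coins
closed. -/
lemma traceLevel_forest_eq (htV : t ∉ Vs) (hd : ∀ v ∈ Vs, arcs (d v) = {(v, par v)})
    (hpar : ∀ v ∈ Vs, par v ∈ Vs ∨ par v = t)
    (honly : ∀ e, (∃ xy ∈ arcs e, xy.1 ∈ Vs) → ∃ v ∈ Vs, e = d v) {rk : V → ℕ}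
    (hrk : ∀ v ∈ Vs, par v ∈ Vs → rk (par v) < rk v) {L : Finset V} (hL : L ⊆ Vs)
    (hdc : DownClosed par t L) :
    traceLevel arcs {t} Vs L = cylinder ((L ∪ bdry Vs par t L).image d) (starState d L) := by
  have hinj := forest_d_injOn hd
  ext ω
  simp only [traceLevel, Set.mem_setOf_eq, mem_cylinder, Finset.mem_image, Finset.mem_union,
    forall_exists_index, and_imp]
  have hbwd : ∀ v, ω ∈ bwdEvent arcs v {t} ↔ Reach arcs ω v t := fun v => by
    simp [bwdEvent]
  constructor
  · intro h e v hv he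
    subst he
    rcases hv with hvL | hvB
    · rw [starState_leaf hinj hL (hL hvL)]
      simp only [hvL, decide_true]
      have hr := (hbwd v).mp ((h v (hL hvL)).mp hvL)
      rcases Relation.ReflTransGen.cases_head hr with heq | ⟨y, hxy, _⟩
      · exact absurd (heq ▸ hL hvL) htV
      · exact (forest_first_arc hd honly (hL hvL) hxy).2
    · have hvB' := mem_bdry_iff.mp hvB
      rw [starState_leaf hinj hL hvB'.1]
      simp only [hvB'.2.1, decide_false]
      have hnr : ¬ Reach arcs ω v t := fun hr => hvB'.2.1 ((h v hvB'.1).mpr ((hbwd v).mpr hr))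
      refine Bool.eq_false_iff.mpr fun hopen => hnr ?_
      have harc : OpenArc arcs ω v (par v) :=
        ⟨d v, hopen, by rw [hd v hvB'.1]; exact Finset.mem_singleton_self _⟩
      rcases hvB'.2.2 with hp | hp
      · exact reach_trans (reach_of_openArc harc) ((hbwd _).mp ((h (par v) (hL hp)).mp hp))
      · rw [hp] at harc
        exact reach_of_openArc harc
  · intro h v hv
    have hopen : ∀ v ∈ L, ω (d v) = true := fun v hv => by
      have := h (d v) v (Or.inl hv) rfl
      rwa [starState_leaf hinj hL (hL hv), decide_eq_true_eq.mpr hv] at this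
    have hclosed : ∀ v ∈ bdry Vs par t L, ω (d v) = false := fun v hv => by
      have hv' := mem_bdry_iff.mp hv
      have := h (d v) v (Or.inr hv) rfl
      rwa [starState_leaf hinj hL hv'.1, decide_eq_false_iff_not.mpr hv'.2.1] at this
    rw [hbwd]
    exact ⟨fun hvL => forest_reach_of_mem hd hrk hL hdc hopen v hvL,
      fun hr => forest_mem_of_reach htV hd hpar honly hclosed v hv hr⟩

omit [Fintype V] [DecidableEq V] [Fintype E] [DecidableEq E] [Field R] [LinearOrder R]
  [IsStrictOrderedRing R] in
/-- A trace that is not down-closed has an empty level. -/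
lemma traceLevel_forest_empty (htV : t ∉ Vs) (hd : ∀ v ∈ Vs, arcs (d v) = {(v, par v)})
    (hpar : ∀ v ∈ Vs, par v ∈ Vs ∨ par v = t)
    (honly : ∀ e, (∃ xy ∈ arcs e, xy.1 ∈ Vs) → ∃ v ∈ Vs, e = d v) {L : Finset V} (hL : L ⊆ Vs)
    (hndc : ¬ DownClosed par t L) : traceLevel arcs {t} Vs L = ∅ := by
  simp only [DownClosed, not_forall, not_or] at hndc
  obtain ⟨v, hv, hpL, hpt⟩ := hndc
  ext ω
  simp only [traceLevel, Set.mem_setOf_eq, Set.mem_empty_iff_false, iff_false]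
  intro h
  have hr : Reach arcs ω v t := by
    have := (h v (hL hv)).mp hv
    simpa [bwdEvent] using this
  rcases Relation.ReflTransGen.cases_head hr with heq | ⟨y, hxy, hyt⟩
  · exact htV (heq ▸ hL hv)
  · obtain ⟨rfl, _⟩ := forest_first_arc hd honly (hL hv) hxy
    have hpV : par v ∈ Vs := (hpar v (hL hv)).resolve_right hpt
    have hmem : par v ∈ L := (h (par v) hpV).mpr ⟨t, Finset.mem_singleton_self t, hyt⟩
    exact hpL hmem

omit [Fintype V] [LinearOrder R] [IsStrictOrderedRing R] in
/-- **The trace law of a forest** at a down-closed `L`: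
`P(K⁻ ∩ Vs = L) = ∏_{v ∈ L} p (d v) · ∏_{v ∈ bdry L} (1 − p (d v))`. -/
theorem prob_traceLevel_forest (p : E → R) (htV : t ∉ Vs)
    (hd : ∀ v ∈ Vs, arcs (d v) = {(v, par v)}) (hpar : ∀ v ∈ Vs, par v ∈ Vs ∨ par v = t)
    (honly : ∀ e, (∃ xy ∈ arcs e, xy.1 ∈ Vs) → ∃ v ∈ Vs, e = d v) {rk : V → ℕ}
    (hrk : ∀ v ∈ Vs, par v ∈ Vs → rk (par v) < rk v) {L : Finset V} (hL : L ⊆ Vs)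
    (hdc : DownClosed par t L) :
    prob p (traceLevel arcs {t} Vs L) =
      (∏ v ∈ L, p (d v)) * ∏ v ∈ bdry Vs par t L, (1 - p (d v)) := by
  have hinj := forest_d_injOn hd
  rw [traceLevel_forest_eq htV hd hpar honly hrk hL hdc, prob_cylinder]
  have hdisj : Disjoint L (bdry Vs par t L) := by
    rw [Finset.disjoint_left]
    intro v hv hb
    exact (mem_bdry_iff.mp hb).2.1 hv
  have hsub : L ∪ bdry Vs par t L ⊆ Vs :=
    Finset.union_subset hL (Finset.filter_subset _ _)
  rw [Finset.prod_image (fun x hx y hy h => hinj (hsub hx) (hsub hy) h), Finset.prod_union hdisj]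
  congr 1
  · refine Finset.prod_congr rfl fun v hv => ?_
    rw [starState_leaf hinj hL (hL hv)]
    simp [hv, edgeFactor]
  · refine Finset.prod_congr rfl fun v hv => ?_
    have hv' := mem_bdry_iff.mp hv
    rw [starState_leaf hinj hL hv'.1]
    simp [hv'.2.1, edgeFactor]

omit [Fintype V] in
/-- **THE TRACE LAW OF A PENDANT FOREST IS LOG-SUPERMODULAR.** -/
theorem forest_trace_lsm (p : E → R) (hp : IsProbVec p) (htV : t ∉ Vs)
    (hd : ∀ v ∈ Vs, arcs (d v) = {(v, par v)}) (hpar : ∀ v ∈ Vs, par v ∈ Vs ∨ par v = t)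
    (honly : ∀ e, (∃ xy ∈ arcs e, xy.1 ∈ Vs) → ∃ v ∈ Vs, e = d v) {rk : V → ℕ}
    (hrk : ∀ v ∈ Vs, par v ∈ Vs → rk (par v) < rk v) :
    ∀ L L', L ⊆ Vs → L' ⊆ Vs →
      prob p (traceLevel arcs {t} Vs L) * prob p (traceLevel arcs {t} Vs L') ≤
        prob p (traceLevel arcs {t} Vs (L ∩ L')) * prob p (traceLevel arcs {t} Vs (L ∪ L')) := by
  intro L L' hL hL'
  have hrhs : 0 ≤ prob p (traceLevel arcs {t} Vs (L ∩ L')) *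
      prob p (traceLevel arcs {t} Vs (L ∪ L')) := mul_nonneg (prob_nonneg hp _) (prob_nonneg hp _)
  by_cases hdc : DownClosed par t L
  · by_cases hdc' : DownClosed par t L'
    · rw [prob_traceLevel_forest p htV hd hpar honly hrk hL hdc,
        prob_traceLevel_forest p htV hd hpar honly hrk hL' hdc',
        prob_traceLevel_forest p htV hd hpar honly hrk (Finset.inter_subset_left.trans hL)
          (downClosed_inter hdc hdc'),
        prob_traceLevel_forest p htV hd hpar honly hrk (Finset.union_subset hL hL')
          (downClosed_union hdc hdc')]
      have hpp : (∏ v ∈ L, p (d v)) * ∏ v ∈ L', p (d v) =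
          (∏ v ∈ L ∩ L', p (d v)) * ∏ v ∈ L ∪ L', p (d v) := by
        rw [mul_comm (∏ v ∈ L ∩ L', p (d v)), Finset.prod_union_inter]
      have hbb := bdry_prod_lsm Vs par t (g := fun v => 1 - p (d v))
        (fun v => by linarith [hp.le_one (d v)]) (fun v => by linarith [hp.nonneg (d v)]) L L'
      have h0 : 0 ≤ (∏ v ∈ L ∩ L', p (d v)) * ∏ v ∈ L ∪ L', p (d v) :=
        mul_nonneg (Finset.prod_nonneg fun v _ => hp.nonneg _)
          (Finset.prod_nonneg fun v _ => hp.nonneg _)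
      have h1 : 0 ≤ (∏ v ∈ bdry Vs par t L, (1 - p (d v))) *
          ∏ v ∈ bdry Vs par t L', (1 - p (d v)) :=
        mul_nonneg (Finset.prod_nonneg fun v _ => by linarith [hp.le_one (d v)])
          (Finset.prod_nonneg fun v _ => by linarith [hp.le_one (d v)])
      calc (∏ v ∈ L, p (d v)) * (∏ v ∈ bdry Vs par t L, (1 - p (d v))) *
            ((∏ v ∈ L', p (d v)) * ∏ v ∈ bdry Vs par t L', (1 - p (d v)))
          = ((∏ v ∈ L, p (d v)) * ∏ v ∈ L', p (d v)) *
              ((∏ v ∈ bdry Vs par t L, (1 - p (d v))) *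
                ∏ v ∈ bdry Vs par t L', (1 - p (d v))) := by ring
        _ ≤ ((∏ v ∈ L ∩ L', p (d v)) * ∏ v ∈ L ∪ L', p (d v)) *
              ((∏ v ∈ bdry Vs par t (L ∩ L'), (1 - p (d v))) *
                ∏ v ∈ bdry Vs par t (L ∪ L'), (1 - p (d v))) := by
            rw [hpp]; exact mul_le_mul_of_nonneg_left hbb h0
        _ = _ := by ring
    · rw [traceLevel_forest_empty htV hd hpar honly hL' hdc', prob_empty, mul_zero]
      exact hrhs
  · rw [traceLevel_forest_empty htV hd hpar honly hL hdc, prob_empty, zero_mul]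
    exact hrhs

end Levels

end ForestLaw

end Summit.Ventures.PercRepro2.Coin
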